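import Summits.CriticalPhenomena.PercolationContinuityZ3.Theses.PercNearOneGluing
import Literature.Probability.Percolation.PercolationProofs
import Literature.Probability.Percolation.ConditionalPositiveAssociationProofs
import Literature.Probability.Percolation.TwoClusterConditionalAssociationProofs

/-! TTRL-lite variant V2062 of stmt-CriticalPhenomena-4576 -/

namespace Summit.CriticalPhenomena.PercolationContinuityZ3.Theorems

open MeasureTheory Literature.Probability.LatticeModels Literature.Probability.Percolation
open scoped Classical BigOperators

/-- TTRL-lite variant V2062 of `stmt-CriticalPhenomena-4576` (move `fix_nat:n=3;card_eq:A=4`).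
The hypothesis `A.card = 4` is impossible for `A : Finset (Fin 3)` (since
`A.card ≤ Fintype.card (Fin 3) = 3`), so the statement holds vacuously. -/
theorem cp4576_goodstep_var2062 :
    ∀ (w : Sym2 (Fin 3) → unitInterval) (A : Finset (Fin 3)) (o b : Fin 3), A.card = 4 → b ∈ A →
    o ∉ A → (∃ y : Fin 3, y ∉ A ∧ y ≠ o ∧ (w s(o, y) : ℝ) ≠ 0) →
    (∀ w' : Sym2 (Fin 3) → unitInterval,
      (Finset.univ.filter (fun v : Fin 3 => ∃ u : Fin 3, 0 < (w' s(u, v) : ℝ))).card <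
        (Finset.univ.filter (fun v : Fin 3 => ∃ u : Fin 3, 0 < (w s(u, v) : ℝ))).card →
      ∀ (A' : Finset (Fin 3)) (o' b' : Fin 3), b' ∈ A' → o' ∉ A' →
      ∀ (t : ℝ) (sel : Finset (Fin 3) → Fin 3), (∀ W, sel W ∈ A') →
      (∀ a ∈ A', 1 - t ≤ (prodBernoulli w').real (openConn a b')) →
      (prodBernoulli w').real ((⋃ a ∈ A', openConn o' a) ∩ (openConn o' b')ᶜ) +
        ∑ W ∈ (Finset.univ : Finset (Finset (Fin 3))).filter (fun W => o' ∈ W ∧ Disjoint W A'),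
          (prodBernoulli w').real {ω : BondConfig (Fin 3) | openCluster ω o' = (W : Set (Fin 3))} *
            (prodBernoulli w').real (openConnIn ((W : Set (Fin 3))ᶜ) (sel W) b')ᶜ ≤ t) →
    ∀ (t : ℝ) (sel : Finset (Fin 3) → Fin 3), (∀ W, sel W ∈ A) →
    (∀ a ∈ A, 1 - t ≤ (prodBernoulli w).real (openConn a b)) →
    (prodBernoulli w).real ((⋃ a ∈ A, openConn o a) ∩ (openConn o b)ᶜ) +
      ∑ W ∈ (Finset.univ : Finset (Finset (Fin 3))).filter (fun W => o ∈ W ∧ Disjoint W A),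
        (prodBernoulli w).real {ω : BondConfig (Fin 3) | openCluster ω o = (W : Set (Fin 3))} *
          (prodBernoulli w).real (openConnIn ((W : Set (Fin 3))ᶜ) (sel W) b)ᶜ ≤ t := by
  intro w A o b hA _ _ _ _ _ _ _ _
  exfalso
  have h := Finset.card_le_univ A
  rw [Fintype.card_fin] at h
  omega

end Summit.CriticalPhenomena.PercolationContinuityZ3.Theorems
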